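import Summits.MatrixMultiplication.MatrixMultiplication.Theorems.AbelianSTPPCensusShapeCertDefs

/-!
# Abelian STPP census — kernel evaluation of the `ShapeCert` checker (D: orders 86, 87, 88, 89, 90, 91, 92, 93, 94, 95, 96, 97, 98, 99)

`check M = true` by `decide +kernel` (no `native_decide`), one theorem per order (per range of small orders),
so that every kernel run starts with empty caches and stays under the default heartbeat budget
(≈ 2–6 s per order below 100, up to ≈ 30 s at the orders 125 and 127).
Consumed by `…ShapeCertFinal` (`check_le_127`).
-/

set_option linter.dupNamespace false -- `MatrixMultiplication.MatrixMultiplication` (summit = problem, D-0017)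
set_option autoImplicit false

namespace Summit.MatrixMultiplication.MatrixMultiplication.Theorems.ShapeCert

/-- certificate check at order `86` (kernel evaluation) -/
theorem check_86 : check 86 = true := by decide +kernel

/-- certificate check at order `87` (kernel evaluation) -/
theorem check_87 : check 87 = true := by decide +kernel

/-- certificate check at order `88` (kernel evaluation) -/
theorem check_88 : check 88 = true := by decide +kernel

/-- certificate check at order `89` (kernel evaluation) -/
theorem check_89 : check 89 = true := by decide +kernel

/-- certificate check at order `90` (kernel evaluation) -/
theorem check_90 : check 90 = true := by decide +kernel

/-- certificate check at order `91` (kernel evaluation) -/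
theorem check_91 : check 91 = true := by decide +kernel

/-- certificate check at order `92` (kernel evaluation) -/
theorem check_92 : check 92 = true := by decide +kernel

/-- certificate check at order `93` (kernel evaluation) -/
theorem check_93 : check 93 = true := by decide +kernel

/-- certificate check at order `94` (kernel evaluation) -/
theorem check_94 : check 94 = true := by decide +kernel

/-- certificate check at order `95` (kernel evaluation) -/
theorem check_95 : check 95 = true := by decide +kernel

/-- certificate check at order `96` (kernel evaluation) -/
theorem check_96 : check 96 = true := by decide +kernel

/-- certificate check at order `97` (kernel evaluation) -/
theorem check_97 : check 97 = true := by decide +kernel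

/-- certificate check at order `98` (kernel evaluation) -/
theorem check_98 : check 98 = true := by decide +kernel

/-- certificate check at order `99` (kernel evaluation) -/
theorem check_99 : check 99 = true := by decide +kernel

end Summit.MatrixMultiplication.MatrixMultiplication.Theorems.ShapeCert
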